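import Literature.NumberTheory.Transcendental.KZHomotopyMoves
import Literature.NumberTheory.Transcendental.KZUnfoldedStokesProofs
import Literature.NumberTheory.Transcendental.KZCubicalCalculus
import Literature.NumberTheory.Transcendental.KZProductIdeal

/-!
# Prism–Stokes engine for path-homotopy invariance, I: cube bookkeeping

Support file for item `PathHomotopyStokes` (stmt-KontsevichZagierPeriods-9660, route
KontsevichZagierPeriods/OctahedralSymmetry), the reusable "prism-Stokes ENGINE": Stokes' formula with
zero bulk for a closed `m`-form on the cube `[0,1]ᵐ⁺¹`, compiled into Kontsevich–Zagier moves — one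
Newton–Leibniz move along each coordinate after a coordinate permutation (rule (2)), and additivity
of the integrand (rule (1b)). This first file collects the coordinate bookkeeping: the permutation
`(finSuccEquiv' i).trans (finSuccEquiv' (Fin.last m)).symm` moving coordinate `i` to the last
place (so that `Fin.snoc y t`, read through it, is `Fin.insertNth i t y`), membership of inserted
points in the open cube `KZ.unitCube`, the band `unitCube m × [0,1]` of the Newton–Leibniz move and
its null difference with the open cube, and semialgebraicity of faces `y ↦ G (Fin.insertNth i c y)`.

References: M. Kontsevich, D. Zagier, *Periods* (2001), §1.2 rules (1)–(3).
Design: theorems only, no definitions, no named facts.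
-/

noncomputable section

open Set MeasureTheory
open Literature.NumberTheory.Transcendental Literature.NumberTheory.Transcendental.KZ
open Literature.ModelTheory.ExponentialFields (IsSemialgebraic)

namespace Summit.KontsevichZagierPeriods.OctahedralSymmetry.PathHomotopyStokes

variable {m : ℕ}

/-! ## The permutation moving coordinate `i` to the last place -/

/-- The permutation `(finSuccEquiv' i).trans (finSuccEquiv' last).symm` sends `i` to `last`.
[folklore] -/
@[simp] theorem toLast_apply_self (i : Fin (m + 1)) :
    ((finSuccEquiv' i).trans (finSuccEquiv' (Fin.last m)).symm) i = Fin.last m := by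
  simp

/-- The permutation `(finSuccEquiv' i).trans (finSuccEquiv' last).symm` sends `i.succAbove k` to
`k.castSucc`. [folklore] -/
@[simp] theorem toLast_apply_succAbove (i : Fin (m + 1)) (k : Fin m) :
    ((finSuccEquiv' i).trans (finSuccEquiv' (Fin.last m)).symm) (i.succAbove k) = Fin.castSucc k := by
  simp

/-- Reading `Fin.snoc y t` through the permutation moving `i` last gives `Fin.insertNth i t y`.
[folklore] -/
theorem snoc_comp_toLast (i : Fin (m + 1)) (y : Fin m → ℝ) (t : ℝ) :
    (fun l => (Fin.snoc y t : Fin (m + 1) → ℝ)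
      (((finSuccEquiv' i).trans (finSuccEquiv' (Fin.last m)).symm) l)) = Fin.insertNth i t y := by
  ext l
  refine Fin.succAboveCases i ?_ (fun k => ?_) l
  · simp
  · rw [toLast_apply_succAbove, Fin.snoc_castSucc, Fin.insertNth_apply_succAbove]

/-- If reading `Fin.snoc y t` through a permutation `e` gives `Fin.insertNth i t y`, then reading any
point `v` through `e` gives `Fin.insertNth i (v last) (Fin.init v)`. [folklore] -/
theorem comp_eq_insertNth_of_snoc {i : Fin (m + 1)} {e : Fin (m + 1) ≃ Fin (m + 1)}
    (he : ∀ (y : Fin m → ℝ) (t : ℝ), (fun l => (Fin.snoc y t : Fin (m + 1) → ℝ) (e l)) = Fin.insertNth i t y)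
    (v : Fin (m + 1) → ℝ) :
    (fun l => v (e l)) = Fin.insertNth i (v (Fin.last m)) (Fin.init v) := by
  conv_lhs => rw [← Fin.snoc_init_self v]
  exact he (Fin.init v) (v (Fin.last m))

/-! ## Cubes -/

/-- A point `Fin.insertNth i t y` lies in the open unit cube iff `t ∈ (0,1)` and `y` lies in the
open unit cube one dimension down. [folklore] -/
theorem insertNth_mem_unitCube_iff (i : Fin (m + 1)) (t : ℝ) (y : Fin m → ℝ) :
    (Fin.insertNth i t y : Fin (m + 1) → ℝ) ∈ unitCube (m + 1) ↔ t ∈ Ioo (0 : ℝ) 1 ∧ y ∈ unitCube m := by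
  simp only [mem_unitCube]
  rw [Fin.forall_iff_succAbove i]
  simp

/-- Updating coordinate `i` of a point of the open unit cube inside `(0,1)` stays in the open unit
cube. [folklore] -/
theorem update_mem_unitCube {x : Fin (m + 1) → ℝ} (hx : x ∈ unitCube (m + 1)) (i : Fin (m + 1))
    {t : ℝ} (ht : t ∈ Ioo (0 : ℝ) 1) : Function.update x i t ∈ unitCube (m + 1) := by
  rw [mem_unitCube] at hx ⊢
  intro l
  by_cases hl : l = i
  · subst hl; simpa using ht
  · rw [Function.update_of_ne hl]; exact hx l

/-- `Fin.removeNth i x` of a point of the open unit cube lies in the open unit cube. [folklore] -/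
theorem removeNth_mem_unitCube {x : Fin (m + 1) → ℝ} (hx : x ∈ unitCube (m + 1)) (i : Fin (m + 1)) :
    (i.removeNth x : Fin m → ℝ) ∈ unitCube m :=
  ((mem_unitCube_succ_iff i x).1 hx).2

/-- The open and the closed unit cubes are invariant under coordinate permutations. [folklore] -/
theorem setOf_comp_perm_mem_unitCube (e : Fin (m + 1) ≃ Fin (m + 1)) :
    {v : Fin (m + 1) → ℝ | (fun l => v (e l)) ∈ unitCube (m + 1)} = unitCube (m + 1) := by
  ext v
  simp only [mem_setOf_eq, mem_unitCube]
  exact ⟨fun h l => by simpa using h (e.symm l), fun h l => h (e l)⟩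

/-- The open unit cube lies in the closed one. [folklore] -/
theorem unitCube_subset_cube (n : ℕ) : unitCube n ⊆ cube n := fun _ hx l =>
  ⟨(mem_unitCube.1 hx l).1.le, (mem_unitCube.1 hx l).2.le⟩

/-! ## The band `unitCube m × [0,1]` -/

/-- Membership in the band `unitCube m × [0,1]` along the last coordinate. [folklore] -/
theorem mem_band_unitCube_iff (v : Fin (m + 1) → ℝ) :
    v ∈ KZlog.band (unitCube m) (fun _ => (0 : ℝ)) (fun _ => 1) ↔
      Fin.init v ∈ unitCube m ∧ 0 ≤ v (Fin.last m) ∧ v (Fin.last m) ≤ 1 := KZlog.mem_band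

/-- The open unit cube lies in the band `unitCube m × [0,1]`. [folklore] -/
theorem unitCube_subset_band :
    unitCube (m + 1) ⊆ KZlog.band (unitCube m) (fun _ => (0 : ℝ)) (fun _ => 1) := by
  intro v hv
  rw [mem_band_unitCube_iff]
  have h := (mem_unitCube_succ_iff (Fin.last m) v).1 hv
  refine ⟨?_, h.1.1.le, h.1.2.le⟩
  simpa [Fin.removeNth_last] using h.2

/-- The band `unitCube m × [0,1]` is the set of points `Fin.snoc y t` with `y` in the open cube and
`t ∈ [0,1]`: read through a permutation `e` turning `Fin.snoc y t` into `Fin.insertNth i t y` it is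
the slab `{x | x i ∈ [0,1], x (i.succAbove k) ∈ (0,1)}`. [folklore] -/
theorem setOf_comp_mem_slab_of_snoc {i : Fin (m + 1)} {e : Fin (m + 1) ≃ Fin (m + 1)}
    (he : ∀ (y : Fin m → ℝ) (t : ℝ), (fun l => (Fin.snoc y t : Fin (m + 1) → ℝ) (e l)) = Fin.insertNth i t y) :
    {v : Fin (m + 1) → ℝ | (fun l => v (e l)) ∈
        {x : Fin (m + 1) → ℝ | x i ∈ Icc (0 : ℝ) 1 ∧ ∀ k, x (i.succAbove k) ∈ Ioo (0 : ℝ) 1}} =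
      KZlog.band (unitCube m) (fun _ => (0 : ℝ)) (fun _ => 1) := by
  ext v
  rw [mem_setOf_eq, comp_eq_insertNth_of_snoc he, mem_band_unitCube_iff]
  simp only [mem_setOf_eq, Fin.insertNth_apply_same, Fin.insertNth_apply_succAbove, mem_Icc,
    mem_unitCube]
  constructor
  · rintro ⟨⟨h0, h1⟩, h⟩; exact ⟨fun k => by simpa [Fin.init] using h k, h0, h1⟩
  · rintro ⟨h, h0, h1⟩; exact ⟨⟨h0, h1⟩, fun k => by simpa [Fin.init] using h k⟩

/-- The open unit cube lies in every slab `{x | x i ∈ [0,1], x (i.succAbove k) ∈ (0,1)}`. [folklore] -/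
theorem unitCube_subset_slab (i : Fin (m + 1)) :
    unitCube (m + 1) ⊆ {x : Fin (m + 1) → ℝ | x i ∈ Icc (0 : ℝ) 1 ∧ ∀ k, x (i.succAbove k) ∈ Ioo (0 : ℝ) 1} :=
  fun _ hx => ⟨⟨(mem_unitCube.1 hx i).1.le, (mem_unitCube.1 hx i).2.le⟩, fun k => mem_unitCube.1 hx (i.succAbove k)⟩

/-- The slab `{x | x i ∈ [0,1], x (i.succAbove k) ∈ (0,1)}` is `ℚ`-semialgebraic (finitely many
polynomial sign conditions). [folklore] -/
theorem isSemialgebraic_slab (i : Fin (m + 1)) :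
    IsSemialgebraic ℚ {x : Fin (m + 1) → ℝ | x i ∈ Icc (0 : ℝ) 1 ∧ ∀ k, x (i.succAbove k) ∈ Ioo (0 : ℝ) 1} := by
  have h1 : IsSemialgebraic ℚ {x : Fin (m + 1) → ℝ | 0 ≤ x i} := by
    have : {x : Fin (m + 1) → ℝ | 0 ≤ x i} =
        {x | 0 ≤ MvPolynomial.aeval x (MvPolynomial.X i : MvPolynomial (Fin (m + 1)) ℚ)} := by
      ext x; simp
    rw [this]
    exact Literature.ModelTheory.ExponentialFields.isSemialgebraic_setOf_eval_nonneg _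
  have h2 : IsSemialgebraic ℚ {x : Fin (m + 1) → ℝ | x i ≤ 1} := by
    have : {x : Fin (m + 1) → ℝ | x i ≤ 1} = {x | 0 ≤ MvPolynomial.aeval x
        (MvPolynomial.C 1 - MvPolynomial.X i : MvPolynomial (Fin (m + 1)) ℚ)} := by
      ext x; simp [sub_nonneg]
    rw [this]
    exact Literature.ModelTheory.ExponentialFields.isSemialgebraic_setOf_eval_nonneg _
  have h3 : IsSemialgebraic ℚ {x : Fin (m + 1) → ℝ | ∀ k, 0 < x (i.succAbove k)} := by
    have : {x : Fin (m + 1) → ℝ | ∀ k, 0 < x (i.succAbove k)} = ⋂ k ∈ (Finset.univ : Finset (Fin m)),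
        {x | 0 < MvPolynomial.aeval x (MvPolynomial.X (i.succAbove k) : MvPolynomial (Fin (m + 1)) ℚ)} := by
      ext x; simp
    rw [this]
    exact IsSemialgebraic.biInter _ _ fun k _ =>
      Literature.ModelTheory.ExponentialFields.isSemialgebraic_setOf_eval_pos _
  have h4 : IsSemialgebraic ℚ {x : Fin (m + 1) → ℝ | ∀ k, x (i.succAbove k) < 1} := by
    have : {x : Fin (m + 1) → ℝ | ∀ k, x (i.succAbove k) < 1} = ⋂ k ∈ (Finset.univ : Finset (Fin m)),
        {x | 0 < MvPolynomial.aeval x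
          (MvPolynomial.C 1 - MvPolynomial.X (i.succAbove k) : MvPolynomial (Fin (m + 1)) ℚ)} := by
      ext x; simp [sub_pos]
    rw [this]
    exact IsSemialgebraic.biInter _ _ fun k _ =>
      Literature.ModelTheory.ExponentialFields.isSemialgebraic_setOf_eval_pos _
  have : {x : Fin (m + 1) → ℝ | x i ∈ Icc (0 : ℝ) 1 ∧ ∀ k, x (i.succAbove k) ∈ Ioo (0 : ℝ) 1} =
      ({x | 0 ≤ x i} ∩ {x | x i ≤ 1}) ∩
        ({x | ∀ k, 0 < x (i.succAbove k)} ∩ {x | ∀ k, x (i.succAbove k) < 1}) := by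
    ext x
    simp only [mem_setOf_eq, mem_inter_iff, mem_Icc, mem_Ioo]
    constructor
    · rintro ⟨⟨h0, h1⟩, h⟩; exact ⟨⟨h0, h1⟩, fun k => (h k).1, fun k => (h k).2⟩
    · rintro ⟨⟨h0, h1⟩, h, h'⟩; exact ⟨⟨h0, h1⟩, fun k => ⟨h k, h' k⟩⟩
  rw [this]
  exact (h1.inter h2).inter (h3.inter h4)

/-- The band `unitCube m × [0,1]` minus the open unit cube lies in the two faces `v last ∈ {0,1}`,
hence is Lebesgue-null. [folklore] -/
theorem volume_band_diff_unitCube :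
    volume (KZlog.band (unitCube m) (fun _ => (0 : ℝ)) (fun _ => 1) \ unitCube (m + 1)) = 0 := by
  have hcov : KZlog.band (unitCube m) (fun _ => (0 : ℝ)) (fun _ => 1) \ unitCube (m + 1) ⊆
      {v | v (Fin.last m) = 0} ∪ {v | v (Fin.last m) = 1} := by
    rintro v ⟨hv, hvU⟩
    rw [mem_band_unitCube_iff] at hv
    simp only [mem_union, mem_setOf_eq]
    by_contra h
    push Not at h
    apply hvU
    rw [mem_unitCube_succ_iff (Fin.last m)]
    refine ⟨⟨lt_of_le_of_ne hv.2.1 (Ne.symm h.1), lt_of_le_of_ne hv.2.2 h.2⟩, ?_⟩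
    simpa [Fin.removeNth_last] using hv.1
  exact measure_mono_null hcov
    (measure_union_null (volume_setOf_last_eq_zero 0) (volume_setOf_last_eq_zero 1))

/-- A function integrable on the open unit cube is integrable on the band `unitCube m × [0,1]`
(the difference is null). [folklore] -/
theorem integrableOn_band_of_unitCube {f : (Fin (m + 1) → ℝ) → ℝ}
    (hf : IntegrableOn f (unitCube (m + 1))) :
    IntegrableOn f (KZlog.band (unitCube m) (fun _ => (0 : ℝ)) (fun _ => 1)) := by
  have hN : IntegrableOn f (KZlog.band (unitCube m) (fun _ => (0 : ℝ)) (fun _ => 1) \ unitCube (m + 1)) := by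
    rw [IntegrableOn, Measure.restrict_eq_zero.2 volume_band_diff_unitCube]
    exact integrable_zero_measure
  exact (hf.union hN).mono_set fun v hv => by
    by_cases h : v ∈ unitCube (m + 1)
    · exact Or.inl h
    · exact Or.inr ⟨hv, h⟩

/-! ## Faces are semialgebraic -/

/-- The face map `y ↦ Fin.insertNth i c y` (`c ∈ ℚ`) is a `ℚ`-polynomial map, so restricting a
function `ℚ`-semialgebraic on the slab `{x | x i ∈ [0,1], x (i.succAbove k) ∈ (0,1)}` to the face
`xᵢ = c`, `c ∈ [0,1] ∩ ℚ`, gives a `ℚ`-semialgebraic function on the open cube.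
[cite: BochnakCosteRoy1998, Prop. 2.2.6] -/
theorem isSemialgebraicFunOn_insertNth_face (i : Fin (m + 1)) {G : (Fin (m + 1) → ℝ) → ℝ}
    (hG : IsSemialgebraicFunOn ℚ
      {x : Fin (m + 1) → ℝ | x i ∈ Icc (0 : ℝ) 1 ∧ ∀ k, x (i.succAbove k) ∈ Ioo (0 : ℝ) 1} G)
    (c : ℚ) (hc : (c : ℝ) ∈ Icc (0 : ℝ) 1) :
    IsSemialgebraicFunOn ℚ (unitCube m) (fun y => G (Fin.insertNth i (c : ℝ) y)) := by
  have hP : IsSemialgebraicMapOn ℚ (unitCube m)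
      (fun y : Fin m → ℝ => (Fin.insertNth i (c : ℝ) y : Fin (m + 1) → ℝ)) := by
    refine (isSemialgebraicMapOn_aeval (isSemialgebraic_unitCube m) (fun l : Fin (m + 1) =>
      (Fin.insertNth (α := fun _ : Fin (m + 1) => MvPolynomial (Fin m) ℚ) i
        (MvPolynomial.C c) (fun k : Fin m => MvPolynomial.X k) l))).congr fun y _ => ?_
    funext l
    refine Fin.succAboveCases i ?_ (fun k => ?_) l
    · simp only [Fin.insertNth_apply_same, MvPolynomial.aeval_C, eq_ratCast]
    · simp only [Fin.insertNth_apply_succAbove, MvPolynomial.aeval_X]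
  refine IsSemialgebraicFunOn.comp_isSemialgebraicMapOn_holds hG hP fun y hy => ?_
  simp only [mem_setOf_eq, Fin.insertNth_apply_same, Fin.insertNth_apply_succAbove]
  exact ⟨hc, fun k => mem_unitCube.1 hy k⟩

end Summit.KontsevichZagierPeriods.OctahedralSymmetry.PathHomotopyStokes

end
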